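import Literature.NumberTheory.Transcendental.ZeroEstOperators
import Literature.NumberTheory.Transcendental.PhilipponZeroEstimateStd
import Literature.NumberTheory.Transcendental.PhilipponZeroEstimateP1nDescent
import HarnessLib

/-!
# Zero estimates on commutative algebraic groups, XVII: the dictionary with `philippon1986_std`

Topic `Literature/NumberTheory/Transcendental`. Bookkeeping between the abstract zero estimate
(`AnalyticGroupModel.zero_estimate`, `ZeroEstMain.lean`) and the shape of the named fact
`Literature.NumberTheory.Transcendental.philippon1986_std` (`PhilipponZeroEstimateStd.lean`):

* `GaGmE.Std.VanishesAlong` IS `VanishesToOrder` (`vanishesAlong_iff_vanishesToOrder`);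
* the set `Σ = {0, v, …, S v}` (`multiples v S`) is finite, contains `0`, and its `k`-fold sumset
  is `{0, v, …, kS v}` (`sumset_multiples`), so the hypothesis "for all `s ≤ nS`" of the named
  fact is the hypothesis "on `Σ(n)`" of Roy's Thm. 4.1;
* for an additive subgroup `H` the number of distinct translates `σ + H`, `σ ∈ Σ`, is the number
  of classes of `Σ` in `V ⧸ H` (`ncard_image_vadd_eq_ncard_image_mk`), and for `Σ = {s v}` the
  latter is `GaGmE.Std.orbitCard` when `H = exp⁻¹(G')` (`ncard_image_mk_multiples`).

Everything is PROVED; no named facts.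

## References

* P. Philippon, *Lemmes de zéros dans les groupes algébriques commutatifs*, Bull. Soc. Math.
  France 114 (1986), 355–383, Thm. 2.1 (`Σ(n)`, `card((Σ + G')/G')`). [Philippon1986]
-/

noncomputable section

open Set
open scoped Pointwise

namespace Literature.NumberTheory.Transcendental

namespace AnalyticGroupModel

variable {V : Type*} [NormedAddCommGroup V] [NormedSpace ℂ V]

/-! ### Orders of vanishing -/

/-- `VanishesAlong = VanishesToOrder`. [folklore] -/
theorem vanishesAlong_iff_vanishesToOrder {β γ δ : Type} [Fintype β] [Fintype γ] [Fintype δ] (𝔟 : Submodule ℂ (β ⊕ (γ ⊕ δ) → ℂ))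
    (F : (β ⊕ (γ ⊕ δ) → ℂ) → ℂ) (w : β ⊕ (γ ⊕ δ) → ℂ) (T : ℕ) :
    GaGmE.Std.VanishesAlong 𝔟 F w T ↔ VanishesToOrder 𝔟 F w T := Iff.rfl

/-! ### The set `Σ = {0, v, …, S v}` -/

/-- `Σ = {s • v ; 0 ≤ s ≤ S}`. [cite: Philippon1986, Thm. 2.1] -/
def multiples (v : V) (S : ℕ) : Set V := (fun s : ℕ => (s : ℂ) • v) '' Set.Iic S

/-- Membership in `Σ`. [folklore] -/
theorem mem_multiples_iff {v : V} {S : ℕ} {x : V} : x ∈ multiples v S ↔ ∃ s : ℕ, s ≤ S ∧ (s : ℂ) • v = x := by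
  simp [multiples]

/-- `Σ` is finite. [folklore] -/
theorem multiples_finite (v : V) (S : ℕ) : (multiples v S).Finite := (Set.finite_Iic S).image _

/-- `0 ∈ Σ`. [folklore] -/
theorem zero_mem_multiples (v : V) (S : ℕ) : (0 : V) ∈ multiples v S :=
  mem_multiples_iff.mpr ⟨0, Nat.zero_le _, by simp⟩

/-- **`Σ(k) = {0, v, …, kS v}`.** [cite: Philippon1986, Thm. 2.1 (Σ(n))] -/
theorem sumset_multiples (v : V) (S k : ℕ) : sumset (multiples v S) k = multiples v (k * S) := by
  induction k with
  | zero =>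
    rw [sumset_zero, Nat.zero_mul]
    ext x
    rw [mem_singleton_iff, mem_multiples_iff]
    constructor
    · rintro rfl; exact ⟨0, le_rfl, by simp⟩
    · rintro ⟨s, hs, rfl⟩
      obtain rfl : s = 0 := Nat.le_zero.mp hs
      simp
  | succ k ih =>
    ext x
    constructor
    · rintro ⟨f, hf, rfl⟩
      -- split off the last summand
      have hlast := hf (Fin.last k)
      have hinit : ∑ i : Fin k, f (Fin.castSucc i) ∈ sumset (multiples v S) k := ⟨fun i => f (Fin.castSucc i), fun i => hf _, rfl⟩
      rw [ih, mem_multiples_iff] at hinit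
      obtain ⟨s₁, hs₁, hs₁eq⟩ := hinit
      obtain ⟨s₂, hs₂, hs₂eq⟩ := mem_multiples_iff.mp hlast
      rw [mem_multiples_iff]
      refine ⟨s₁ + s₂, by rw [Nat.succ_mul]; omega, ?_⟩
      rw [Fin.sum_univ_castSucc, ← hs₁eq, ← hs₂eq, Nat.cast_add, add_smul]
    · rintro hx
      rw [mem_multiples_iff] at hx
      obtain ⟨s, hs, rfl⟩ := hx
      -- write `s = s₁ + s₂` with `s₁ ≤ kS`, `s₂ ≤ S`
      set s₂ := min s S with hs₂
      set s₁ := s - s₂ with hs₁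
      have hs₁le : s₁ ≤ k * S := by
        rw [Nat.succ_mul] at hs
        rcases le_total s S with h | h
        · have : s₂ = s := min_eq_left h
          omega
        · have : s₂ = S := min_eq_right h
          omega
      have hsum : s = s₁ + s₂ := by omega
      have hmem : (s₁ : ℂ) • v ∈ sumset (multiples v S) k := by
        rw [ih, mem_multiples_iff]; exact ⟨s₁, hs₁le, rfl⟩
      have := add_mem_sumset_succ hmem (mem_multiples_iff.mpr ⟨s₂, min_le_right _ _, rfl⟩ : (s₂ : ℂ) • v ∈ multiples v S)
      rwa [← add_smul, ← Nat.cast_add, ← hsum] at this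

/-! ### Counting cosets -/

omit [NormedSpace ℂ V] in
/-- Two translates of a subgroup agree iff the translating elements agree modulo the subgroup.
[folklore] -/
theorem vadd_coe_eq_iff (H : AddSubgroup V) (a b : V) :
    a +ᵥ ((H : AddSubgroup V) : Set V) = b +ᵥ ((H : AddSubgroup V) : Set V) ↔
      (QuotientAddGroup.mk a : V ⧸ H) = QuotientAddGroup.mk b := by
  rw [leftAddCoset_eq_iff, QuotientAddGroup.eq]

omit [NormedSpace ℂ V] in
/-- **The number of distinct translates `σ + H`, `σ ∈ Σ`, is the number of classes of `Σ` in
`V ⧸ H`.** [folklore] -/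
theorem ncard_image_vadd_eq_ncard_image_mk (H : AddSubgroup V) {Sset : Set V} (hS : Sset.Finite) :
    ((fun σ => σ +ᵥ ((H : AddSubgroup V) : Set V)) '' Sset).ncard =
      ((QuotientAddGroup.mk : V → V ⧸ H) '' Sset).ncard :=
  GaGm.Descent.ncard_image_eq_of_fibres hS _ _ fun a _ b _ => vadd_coe_eq_iff H a b

omit [NormedSpace ℂ V] in
/-- The classes of `Σ = {s v ; s ≤ S}` in `V ⧸ H` are the range used by `orbitCard`. [folklore] -/
theorem image_mk_multiples {W : Type*} [NormedAddCommGroup W] [NormedSpace ℂ W] (H : AddSubgroup W) (v : W) (S : ℕ) :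
    (QuotientAddGroup.mk : W → W ⧸ H) '' multiples v S =
      Set.range fun s : Fin (S + 1) => (QuotientAddGroup.mk ((s : ℂ) • v) : W ⧸ H) := by
  ext q
  simp only [mem_image, mem_multiples_iff, mem_range]
  constructor
  · rintro ⟨x, ⟨s, hs, rfl⟩, rfl⟩
    exact ⟨⟨s, Nat.lt_succ_of_le hs⟩, rfl⟩
  · rintro ⟨s, rfl⟩
    exact ⟨(s : ℂ) • v, ⟨s, Nat.le_of_lt_succ s.2, rfl⟩, rfl⟩

/-- **`card{σ + exp⁻¹(G') ; σ ∈ Σ} = orbitCard`** for `Σ = {0, v, …, S v}`. [cite: Philippon1986, Thm. 2.1 (card((Σ+G')/G'))] -/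
theorem ncard_image_vadd_multiples_eq_orbitCard {β γ δ : Type} [Fintype β] [Fintype γ] [Fintype δ] [DecidableEq γ]
    (L : PeriodPair) (κM : δ → γ → GaGmE.Kbar) (K : GaGmE.Std.SubgroupDataC β γ δ κM) (v : β ⊕ (γ ⊕ δ) → ℂ) (S : ℕ) :
    ((fun σ => σ +ᵥ ((GaGmE.Std.preimageSubgroup L κM K : AddSubgroup (β ⊕ (γ ⊕ δ) → ℂ)) : Set (β ⊕ (γ ⊕ δ) → ℂ))) ''
        multiples v S).ncard = GaGmE.Std.orbitCard L κM K v S := by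
  rw [ncard_image_vadd_eq_ncard_image_mk _ (multiples_finite v S), image_mk_multiples]
  rfl

end AnalyticGroupModel

end Literature.NumberTheory.Transcendental
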